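import Literature.NumberTheory.Automorphic.HilbertRepIsotypicComponent
import Literature.NumberTheory.Automorphic.CompactGroupKFiniteVectorsPeterWeyl
import HarnessLib

/-!
# An irreducible unitary representation of `G × K`, `K` compact, restricts on `K` to ONE isotypic type

Topic `Literature/RepresentationTheory/CompactGroups`; THEOREMS ONLY (no definition, no instance, no named fact,
no `sorry`), in the Hilbert-space vocabulary of `HilbertRepSpectrum` / `HilbertRepIsotypicComponent`
(`ContRepresentation.IsUnitary`, `IsStronglyContinuous`, `IsTopIrreducible`, `ClosedSubrep`, `isotypicComponent`,
`AreUnitarilyEquivalent`) and Mathlib's `ContRepresentation.restrict` along `MonoidHom.inr G K : K →* G × K`.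

Let `Π` be a unitary representation of a product group `G × K` on a complex Hilbert space `H` and write
`Π|_K := Π.restrict (MonoidHom.inr G K)`.

* `comp_eq_apply_mul`, `restrict_inl_comp_restrict_inr`, `restrict_inl_restrict_inr_apply` — `Π(g,1) ∘ Π(1,k) =
  Π(1,k) ∘ Π(g,1) = Π(g,k)`; any monoids.
* `apply_mem_isotypicComponent_restrict_inr` — **every isotypic component `H_σ` of `Π|_K` is `Π(G × K)`-stable**
  (the operators `Π(g,1)` commute with `Π|_K`, and isotypic components are stable under the commutant,
  `apply_mem_isotypicComponent_of_commute`; Deitmar–Echterhoff (2014) Prop. 7.3.3, Dixmier (1977) §5.4); any groups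
  `G`, `K`, no topology on `K`.
* `isotypicComponent_restrict_inr_eq_bot_or_eq_top` — if `Π` is topologically irreducible, every `H_σ` is `0` or `H`;
  `isotypicComponent_restrict_inr_eq_top_of_ne_bot`; `areUnitarilyEquivalent_of_isotypicComponent_restrict_inr_ne_bot`
  — two classes `σ`, `σ'` occurring in `Π|_K` are unitarily equivalent (inequivalent components are orthogonal,
  `isOrtho_isotypicComponent`, and cannot both be `H ≠ 0`).  Any groups, no topology on `K`.
* `areUnitarilyEquivalent_of_isotypicComponent_restrict_inr_eq_top` — if `H_σ = H` then EVERY irreducible closed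
  `K`-subrepresentation of `Π|_K` is `≃ σ` (Dixmier (1977) 5.4.4, `IsUnitary.exists_mem_areUnitarilyEquivalent`).
* **`exists_isotypicComponent_restrict_inr_eq_top`** — for `K` a COMPACT Hausdorff group and `Π|_K` strongly
  continuous: there is an irreducible, finite-dimensional closed `K`-subrepresentation `W ≤ Π|_K` with `H_W = H`, i.e.
  **`Π|_K` is isotypic of a single finite-dimensional type** — Peter–Weyl (`isDiscretelyDecomposable_of_compactSpace`,
  `finiteDimensional_of_isTopIrreducible_toContRep`, Bröcker–tom Dieck III (5.8), (5.10)) supplies an irreducible `W`,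
  and the dichotomy above forces `H_W = H`;
  **`exists_unique_type_restrict_inr`** — the packaged statement: such a `W` exists and every irreducible closed
  `K`-subrepresentation of `Π|_K` is unitarily equivalent to `W`.

This is the Hilbert-space form of the printed statement «an irreducible unitary representation of `G₁ × G_c` with
`G_c` compact is `π₁ ⊗ σ` with `σ` an irreducible (finite-dimensional) representation of `G_c`; in particular its
restriction to `G_c` is `σ`-isotypic» (Deitmar–Echterhoff (2014), Thm. 7.5.26 / §7.5 for `K` compact; Bump (1997),
§3.4, Prop. 3.4.1–3.4.4 for the algebraic shadow, in the tree as `Semisimple/ProductGroupIsotypicRestriction`;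
Flath (1979) Thm. 3 for restricted tensor products).  The finite-dimensional unitary converse «`(π ⊗ σ)|_K` is
`σ`-isotypic» is the tree's `CompactGroups/OuterTensorProductIsotypicRestriction`.  NOT here: the tensor-product
decomposition `Π ≅ π₁ ⊗̂ σ` itself (it needs the multiplicity space `Hom_K(σ, Π)` as a `G`-representation; see
`CompactGroupMultiplicitySpace`, `ProductGroupTensorHomMultiplicity`).

## References
* A. Deitmar, S. Echterhoff, *Principles of Harmonic Analysis*, 2nd ed. (2014), Thm. 7.2.3, §7.3 (Prop. 7.3.3,
  Thm. 7.3.2) [DeitmarEchterhoff2014].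
* J. Dixmier, *C\*-algebras* (1977), §5.4 (5.4.1, 5.4.4), §13.1 [Dixmier1977].
* T. Bröcker, T. tom Dieck, *Representations of Compact Lie Groups*, GTM 98 (1985), III (5.8), Thm. (5.10)
  [BrockerTomDieck1985].

## Provenance
Cell `hodgecm-mathlib` (HOME `run/shared/lean/pub/hodgecm-mathlib/`), seat B-p05 (g25); generic carrier lemma behind the
compact-place class token of the `H413` floor (F0∕P3 desk word 2026-08-31T09:44:30Z).
-/

noncomputable section

open scoped InnerProductSpace
open Literature.NumberTheory.Automorphic

namespace ContRepresentation

/-! ### Commuting operators: `Π(g,1)` versus `Π(1,k)` -/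

section Commute

variable {G K : Type*} [Monoid G] [Monoid K]
variable {H : Type*} [NormedAddCommGroup H] [InnerProductSpace ℂ H]
variable (ρ : ContRepresentation ℂ (G × K) H)

/-- `Π a ∘ Π b = Π (a b)` (the representation property, with `∘L` for the product in `H →L[ℂ] H`).
A deliberate dot-notation extension of Mathlib's `ContRepresentation`. [cite: Dixmier1977, §13.1] -/
theorem comp_eq_apply_mul (a b : G × K) : ρ a ∘L ρ b = ρ (a * b) := by
  rw [map_mul]
  rfl

/-- `Π(g,1) ∘ Π(1,k) = Π(1,k) ∘ Π(g,1)`: both equal `Π(g,k)` (Dixmier (1977), §13.1.8, representations of a product).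
[cite: Dixmier1977, §13.1] -/
theorem restrict_inl_comp_restrict_inr (g : G) (k : K) :
    ρ.restrict (MonoidHom.inl G K) g ∘L ρ.restrict (MonoidHom.inr G K) k =
      ρ.restrict (MonoidHom.inr G K) k ∘L ρ.restrict (MonoidHom.inl G K) g := by
  change ρ (g, 1) ∘L ρ (1, k) = ρ (1, k) ∘L ρ (g, 1)
  rw [comp_eq_apply_mul, comp_eq_apply_mul, Prod.mk_mul_mk, Prod.mk_mul_mk, mul_one, one_mul, one_mul, mul_one]

/-- `Π(g,1) (Π(1,k) v) = Π(g,k) v`. [cite: Dixmier1977, §13.1] -/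
theorem restrict_inl_restrict_inr_apply (x : G × K) (v : H) :
    ρ.restrict (MonoidHom.inl G K) x.1 (ρ.restrict (MonoidHom.inr G K) x.2 v) = ρ x v := by
  change ρ (x.1, 1) (ρ (1, x.2) v) = ρ x v
  rw [← ContinuousLinearMap.comp_apply, comp_eq_apply_mul, Prod.mk_mul_mk, mul_one, one_mul]

end Commute

/-! ### Isotypic components of `Π|_K` are `Π`-stable; the irreducible dichotomy -/

section AnyGroups

variable {G K : Type*} [Group G] [Group K]
variable {H : Type*} [NormedAddCommGroup H] [InnerProductSpace ℂ H] [CompleteSpace H]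
variable {H' : Type*} [NormedAddCommGroup H'] [InnerProductSpace ℂ H']
variable {H'' : Type*} [NormedAddCommGroup H''] [InnerProductSpace ℂ H'']
variable {ρ : ContRepresentation ℂ (G × K) H}

/-- The restriction `Π|_K` of a unitary representation is unitary (Dixmier (1977), §13.1.1; Folland (1995), §3.1).
[cite: Dixmier1977, §13.1] -/
theorem IsUnitary.restrict_inr (hρ : ρ.IsUnitary) : (ρ.restrict (MonoidHom.inr G K)).IsUnitary :=
  fun _ => hρ _

/-- **Every isotypic component `H_σ` of `Π|_K` is stable under all of `Π(G × K)`**: `Π(1,k)` preserves it because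
it is a `K`-subrepresentation, and `Π(g,1)` because it commutes with `Π|_K` (isotypic components are stable under
the commutant, Deitmar–Echterhoff (2014), Prop. 7.3.3; Dixmier (1977), §5.4). [cite: DeitmarEchterhoff2014, Prop. 7.3.3] -/
theorem apply_mem_isotypicComponent_restrict_inr (hρ : ρ.IsUnitary) (σ : ContRepresentation ℂ K H')
    (x : G × K) {v : H} (hv : v ∈ (ρ.restrict (MonoidHom.inr G K)).isotypicComponent σ) :
    ρ x v ∈ (ρ.restrict (MonoidHom.inr G K)).isotypicComponent σ := by
  rw [← restrict_inl_restrict_inr_apply ρ x v]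
  exact apply_mem_isotypicComponent_of_commute hρ.restrict_inr
    (fun k => restrict_inl_comp_restrict_inr ρ x.1 k) (ClosedSubrep.apply_mem _ x.2 hv)

/-- The isotypic component `H_σ` of `Π|_K`, viewed as a closed subrepresentation of `Π` itself
(`ClosedSubrep.ofSubmodule` with `apply_mem_isotypicComponent_restrict_inr`), has the same vectors (plumbing). [folklore] -/
private theorem mem_ofSubmodule_isotypicComponent_restrict_inr_iff (hρ : ρ.IsUnitary) (σ : ContRepresentation ℂ K H')
    (v : H) :
    v ∈ ClosedSubrep.ofSubmodule (π := ρ) ((ρ.restrict (MonoidHom.inr G K)).isotypicComponent σ).toSubmodule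
        ((ρ.restrict (MonoidHom.inr G K)).isotypicComponent σ).isClosed'
        (fun x _ hw => apply_mem_isotypicComponent_restrict_inr hρ σ x hw) ↔
      v ∈ (ρ.restrict (MonoidHom.inr G K)).isotypicComponent σ :=
  Iff.rfl

/-- **Dichotomy.** If `Π` is topologically irreducible, every isotypic component of `Π|_K` is `0` or everything:
it is a closed `Π(G × K)`-stable subspace (`apply_mem_isotypicComponent_restrict_inr`).
(Deitmar–Echterhoff (2014), §7.3 with Schur; Dixmier (1977), §5.4.) [cite: DeitmarEchterhoff2014, §7.3] -/
theorem isotypicComponent_restrict_inr_eq_bot_or_eq_top (hρ : ρ.IsUnitary) (hirr : ρ.IsTopIrreducible)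
    (σ : ContRepresentation ℂ K H') :
    (ρ.restrict (MonoidHom.inr G K)).isotypicComponent σ = ⊥ ∨
      (ρ.restrict (MonoidHom.inr G K)).isotypicComponent σ = ⊤ := by
  set N := (ρ.restrict (MonoidHom.inr G K)).isotypicComponent σ with hN
  let M : ClosedSubrep ρ := ClosedSubrep.ofSubmodule (π := ρ) N.toSubmodule N.isClosed'
    (fun x _ hw => apply_mem_isotypicComponent_restrict_inr hρ σ x hw)
  rcases ((isTopIrreducible_iff ρ).mp hirr).2 M with hM | hM
  · refine Or.inl (ClosedSubrep.ext fun v => ?_)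
    show v ∈ M ↔ v ∈ (⊥ : ClosedSubrep (ρ.restrict (MonoidHom.inr G K)))
    rw [hM, ClosedSubrep.mem_bot, ClosedSubrep.mem_bot]
  · refine Or.inr (ClosedSubrep.ext fun v => ?_)
    show v ∈ M ↔ v ∈ (⊤ : ClosedSubrep (ρ.restrict (MonoidHom.inr G K)))
    rw [hM]
    exact ⟨fun _ => ClosedSubrep.mem_top v, fun _ => ClosedSubrep.mem_top v⟩

/-- If `Π` is irreducible and the class of `σ` OCCURS in `Π|_K` (`H_σ ≠ 0`), then `H_σ = H`: `Π|_K` is purely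
`σ`-isotypic. [cite: DeitmarEchterhoff2014, §7.3] -/
theorem isotypicComponent_restrict_inr_eq_top_of_ne_bot (hρ : ρ.IsUnitary) (hirr : ρ.IsTopIrreducible)
    {σ : ContRepresentation ℂ K H'} (hσ : (ρ.restrict (MonoidHom.inr G K)).isotypicComponent σ ≠ ⊥) :
    (ρ.restrict (MonoidHom.inr G K)).isotypicComponent σ = ⊤ :=
  (isotypicComponent_restrict_inr_eq_bot_or_eq_top hρ hirr σ).resolve_left hσ

/-- An irreducible closed `K`-subrepresentation `W ≤ Π|_K` makes `Π|_K` purely `W`-isotypic. [cite: DeitmarEchterhoff2014, §7.3] -/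
theorem isotypicComponent_restrict_inr_toContRep_eq_top (hρ : ρ.IsUnitary) (hirr : ρ.IsTopIrreducible)
    {W : ClosedSubrep (ρ.restrict (MonoidHom.inr G K))} (hW : W.toContRep.IsTopIrreducible) :
    (ρ.restrict (MonoidHom.inr G K)).isotypicComponent W.toContRep = ⊤ := by
  refine isotypicComponent_restrict_inr_eq_top_of_ne_bot hρ hirr fun h => ?_
  have hle : W ≤ (ρ.restrict (MonoidHom.inr G K)).isotypicComponent W.toContRep :=
    le_isotypicComponent hW (AreUnitarilyEquivalent.refl _)
  rw [h, le_bot_iff] at hle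
  exact ClosedSubrep.ne_bot_of_isTopIrreducible hW hle

/-- **Uniqueness of the type.** If `Π` is irreducible, two classes `σ`, `σ'` both occurring in `Π|_K` are unitarily
equivalent: otherwise `H_σ ⟂ H_{σ'}` (`isOrtho_isotypicComponent`, Deitmar–Echterhoff (2014), Thm. 7.3.2 (c)) while
both are `H ≠ 0`. [cite: DeitmarEchterhoff2014, Thm. 7.3.2] -/
theorem areUnitarilyEquivalent_of_isotypicComponent_restrict_inr_ne_bot (hρ : ρ.IsUnitary)
    (hirr : ρ.IsTopIrreducible) {σ : ContRepresentation ℂ K H'} {σ' : ContRepresentation ℂ K H''}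
    (hσ : (ρ.restrict (MonoidHom.inr G K)).isotypicComponent σ ≠ ⊥)
    (hσ' : (ρ.restrict (MonoidHom.inr G K)).isotypicComponent σ' ≠ ⊥) :
    AreUnitarilyEquivalent σ σ' := by
  by_contra hne
  have horth := isOrtho_isotypicComponent (π := ρ.restrict (MonoidHom.inr G K)) hρ.restrict_inr hne
  rw [isotypicComponent_restrict_inr_eq_top_of_ne_bot hρ hirr hσ,
    isotypicComponent_restrict_inr_eq_top_of_ne_bot hρ hirr hσ', ClosedSubrep.toSubmodule_top,
    Submodule.isOrtho_self] at horth
  haveI : Nontrivial H := ((isTopIrreducible_iff ρ).mp hirr).1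
  exact top_ne_bot horth

/-- If `H_σ = H` for `Π|_K`, then **every irreducible closed `K`-subrepresentation of `Π|_K` is unitarily equivalent
to `σ`** (Dixmier (1977), 5.4.4: an irreducible subrepresentation of a unitary representation densely spanned by
irreducibles is equivalent to one of them; `IsUnitary.exists_mem_areUnitarilyEquivalent`). [cite: Dixmier1977, 5.4.4] -/
theorem areUnitarilyEquivalent_of_isotypicComponent_restrict_inr_eq_top (hρ : ρ.IsUnitary)
    {σ : ContRepresentation ℂ K H'} (hσ : (ρ.restrict (MonoidHom.inr G K)).isotypicComponent σ = ⊤)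
    {V : ClosedSubrep (ρ.restrict (MonoidHom.inr G K))} (hV : V.toContRep.IsTopIrreducible) :
    AreUnitarilyEquivalent V.toContRep σ := by
  obtain ⟨W, hW, hVW⟩ := hρ.restrict_inr.exists_mem_areUnitarilyEquivalent
    (S := (ρ.restrict (MonoidHom.inr G K)).isotypicMembers σ) (fun W hW => hW.1) hσ hV
  exact hVW.trans hW.2

end AnyGroups

/-! ### Compact `K`: existence of the (finite-dimensional) type -/

section Compact

variable {G K : Type*} [Group G] [Group K] [TopologicalSpace K] [IsTopologicalGroup K] [CompactSpace K]
  [T2Space K]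
variable {H : Type*} [NormedAddCommGroup H] [InnerProductSpace ℂ H] [CompleteSpace H]
variable {ρ : ContRepresentation ℂ (G × K) H}

/-- **`Π|_K` is isotypic of one finite-dimensional type.** For `Π` a topologically irreducible unitary representation
of `G × K` on a Hilbert space with `K` compact Hausdorff and `Π|_K` strongly continuous, there is an irreducible
finite-dimensional closed `K`-subrepresentation `W ≤ Π|_K` whose isotypic component is all of `H`.  Peter–Weyl
(`isDiscretelyDecomposable_of_compactSpace`, Bröcker–tom Dieck III Thm. (5.10); `finiteDimensional_of_isTopIrreducible_toContRep`,
III (5.8)) gives an irreducible `W`; the dichotomy `isotypicComponent_restrict_inr_eq_bot_or_eq_top` does the rest.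
(Deitmar–Echterhoff (2014), Thm. 7.2.3 with §7.3.) [cite: BrockerTomDieck1985, III Thm (5.10)] [cite: DeitmarEchterhoff2014, Thm 7.2.3] -/
theorem exists_isotypicComponent_restrict_inr_eq_top (hρ : ρ.IsUnitary)
    (hc : (ρ.restrict (MonoidHom.inr G K)).IsStronglyContinuous) (hirr : ρ.IsTopIrreducible) :
    ∃ W : ClosedSubrep (ρ.restrict (MonoidHom.inr G K)),
      W.toContRep.IsTopIrreducible ∧ FiniteDimensional ℂ W.toSubmodule ∧
        (ρ.restrict (MonoidHom.inr G K)).isotypicComponent W.toContRep = ⊤ := by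
  haveI : Nontrivial H := ((isTopIrreducible_iff ρ).mp hirr).1
  have htop : (⊤ : ClosedSubrep (ρ.restrict (MonoidHom.inr G K))) ≠ ⊥ := by
    intro h
    obtain ⟨v, hv⟩ := exists_ne (0 : H)
    have hv' : v ∈ (⊤ : ClosedSubrep (ρ.restrict (MonoidHom.inr G K))) := ClosedSubrep.mem_top v
    rw [h] at hv'
    exact hv (ClosedSubrep.mem_bot.mp hv')
  obtain ⟨W, hW, -⟩ := hρ.restrict_inr.exists_isTopIrreducible_le_of_isDiscretelyDecomposable
    (isDiscretelyDecomposable_of_compactSpace hc hρ.restrict_inr) htop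
  exact ⟨W, hW, finiteDimensional_of_isTopIrreducible_toContRep hc hW,
    isotypicComponent_restrict_inr_toContRep_eq_top hρ hirr hW⟩

/-- **The `K`-type of an irreducible unitary representation of `G × K` (`K` compact).** There is an irreducible
finite-dimensional closed `K`-subrepresentation `W ≤ Π|_K` such that `Π|_K` is purely `W`-isotypic AND every
irreducible closed `K`-subrepresentation of `Π|_K` is unitarily equivalent to `W`
(Deitmar–Echterhoff (2014), Thm. 7.2.3, §7.3; Dixmier (1977), 5.4.4). [cite: DeitmarEchterhoff2014, Thm 7.2.3] [cite: Dixmier1977, 5.4.4] -/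
theorem exists_unique_type_restrict_inr (hρ : ρ.IsUnitary)
    (hc : (ρ.restrict (MonoidHom.inr G K)).IsStronglyContinuous) (hirr : ρ.IsTopIrreducible) :
    ∃ W : ClosedSubrep (ρ.restrict (MonoidHom.inr G K)),
      W.toContRep.IsTopIrreducible ∧ FiniteDimensional ℂ W.toSubmodule ∧
        (ρ.restrict (MonoidHom.inr G K)).isotypicComponent W.toContRep = ⊤ ∧
          ∀ V : ClosedSubrep (ρ.restrict (MonoidHom.inr G K)), V.toContRep.IsTopIrreducible →
            AreUnitarilyEquivalent V.toContRep W.toContRep := by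
  obtain ⟨W, hW, hfd, htop⟩ := exists_isotypicComponent_restrict_inr_eq_top hρ hc hirr
  exact ⟨W, hW, hfd, htop, fun V hV => areUnitarilyEquivalent_of_isotypicComponent_restrict_inr_eq_top hρ htop hV⟩

/-- In particular **every irreducible closed `K`-subrepresentation of `Π|_K` is finite-dimensional and any two are
unitarily equivalent**. [cite: DeitmarEchterhoff2014, Thm 7.2.3] -/
theorem areUnitarilyEquivalent_of_isTopIrreducible_restrict_inr (hρ : ρ.IsUnitary)
    (hc : (ρ.restrict (MonoidHom.inr G K)).IsStronglyContinuous) (hirr : ρ.IsTopIrreducible)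
    {V V' : ClosedSubrep (ρ.restrict (MonoidHom.inr G K))} (hV : V.toContRep.IsTopIrreducible)
    (hV' : V'.toContRep.IsTopIrreducible) :
    AreUnitarilyEquivalent V.toContRep V'.toContRep := by
  obtain ⟨W, -, -, -, hall⟩ := exists_unique_type_restrict_inr hρ hc hirr
  exact (hall V hV).trans (hall V' hV').symm

end Compact

end ContRepresentation

end
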